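import Summits.CriticalPhenomena.PercolationContinuityZ3.Theorems.PercNearOneGluingNoHeavyQuantThreeRootGateCoupling
import HarnessLib

/-!
# QUANT lane R8, T-DEC: THE GENERIC THREE-ROOT GATE-COUPLING IDENTITY (four components, unequal root gates and unequal subtrees)

builds on p205010 (kernel theorem, internal audit signed; external expert review pending)

Support file (`--supports stmt-CriticalPhenomena-4575`), QUANT lane seat prim-quant-arm-1 (gen 46, architect; lead g43 ask V403 (2)
"the generic k = 3 pattern identity"); memo `run/shared/lean/prim/quant/prim-quant-arm-1-g46/ARCH-LIGHT-G46.md` §2.  Theorems only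
(pure algebra of `gate`/`lconv`), standard axioms, no sorries.  Companion of arm-1 g45's `twoRoot_gateCoupling` (`…QuantTwoRootGateCoupling`)
and census-2 g71's tied identity `threeRoot_gateCoupling` (`…QuantThreeRootGateCoupling`, whose `lconv3_gate_expand` is the engine here).

THE IDENTITY (`threeRoot_gateCoupling_generic`).  Three trees `tᵢ = gate_{qᵢ} ρᵢ` under an outer gate `a`; boxes 1, 2 form the PAIR
(box 1 the hub), box 3 is the SINGLE.  Write `Q = q₁ + q₂ − q₁q₂` (the pair's compound root gate), `w = (1−Q)/(1−aQ)`,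
`w₁₂ = (1−q₁)/(1−aq₁)`, and, for two further real parameters `R₁, R₂` (in the application: the means of `ρ₁, ρ₂`),
`D = q₁(1−q₂)R₂ + q₂(1−q₁)R₁`, `x₁ = q₁(1−q₂)R₂/D`, `x₂ = q₂(1−q₁)R₁/D`, `λ₂ = q₂(R₂ − (1−q₁)R₁)/(Q R₂)`, `λ₁ = q₁(R₁ − (1−q₂)R₂)/(Q R₁)`.  Then, pointwise,
  `gate_a(t₁ ∗ t₂ ∗ t₃) = w·w₁₂ · P + w(1−w₁₂) · C + (1−w)x₁ · U₁ + (1−w)x₂ · U₂`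
with  `P = gate_{aq₁}ρ₁ ∗ gate_{aq₂}ρ₂ ∗ gate_{aq₃}ρ₃`  (product),  `C = gate_{aq₁}(ρ₁ ∗ gate_{q₂/q₁}ρ₂) ∗ gate_{aq₃}ρ₃`  (box 3 beside the
two-root `U`-component of the pair),  `U₁ = gate_{aQ}(ρ₁ ∗ gate_{λ₂}ρ₂ ∗ gate_{q₃/Q}ρ₃)`  (hub 1 opened, box 2 re-gated to `λ₂`, box 3 to `q₃/Q`),
`U₂ = gate_{aQ}(gate_{λ₁}ρ₁ ∗ ρ₂ ∗ gate_{q₃/Q}ρ₃)`.  It is an identity of rational functions in `(a, q₁, q₂, q₃, R₁, R₂)` on the eight sub-forest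
convolutions (`lconv3_gate_expand`); `R₃` does not enter.  DERIVATION (memo §2): the two-root identity for (compound pair | box 3) — valid because
`t₁ ∗ t₂ = gate_Q(ρ₁₂)` with `ρ₁₂` the pair law conditioned on "a root open" — then the two-root identity inside the product part, and in the
`U`-part the exact blend `(1−λ)·[hub alone] + λ·[both hubs opened] = [hub, other box at gate λ]` with `λ` chosen so that BOTH blends have the mean
of the target; the blend exhausts the both-opened piece exactly (`x₁ + x₂ = 1`, `threeRoot_generic_weights`).

WHY IT MATTERS.  With `Rᵢ` the means of `ρᵢ` and `S = a(q₁R₁ + q₂R₂ + q₃R₃)`: all four components have mean EXACTLY `S`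
(`threeRoot_generic_means`), every tree of every component has at most `n₁+n₂+n₃+2` nontrivial gates (one fewer than `t₁ ⊔ t₂ ⊔ t₃`: `U₁`, `U₂`
open a hub), and the weights are a probability vector as soon as `Q ≥ q₃`... precisely: `w, w₁₂ ∈ [0,1]` for `a ≤ 1`, `x₁, x₂ ≥ 0`, and the
re-gates `λ₁, λ₂` lie in `[0,1]` iff `R₁ ≥ (1−q₂)R₂` and `R₂ ≥ (1−q₁)R₁`; `q₂/q₁ ≤ 1` needs box 1 to be the heavier root of the pair and `q₃/Q ≤ 1`
holds whenever `q₃ ≤ max(q₁,q₂)`.  FLOORS: boxes 3 (everywhere) and the hubs keep or raise their natural marginals `a qᵢ`; box 2 in `U₁` sits at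
`a q₂(1 − (1−q₁)R₁/R₂)`, box 1 in `U₂` at `a q₁(1 − (1−q₂)R₂/R₁)` — so inside `LawDec.GateStepN` (lead g42) the identity is a certificate exactly
when the floor-carrying box is taken as the single and the two pair boxes have that much floor slack: the FIRST explicit width-3 certificate
on an OPEN (generic) region of the core; on generic three-2-chain sibling groups it certifies ≈ 60 % of instances outright (memo §4; the
tied corner is excluded, in line with the genericity principle README V402).  The DEC consequence inside `GateStepN` is left to the sequel.

HONEST STATUS.  `GateStepN`, `GateStepNCore`, `FarTreeRow` remain OPEN; RATE class (log\*) and the honest sentence of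
`run/shared/lean/prim/quant/README.md` unchanged.  [this work]; two-root identity: prim-quant-arm-1 g45; `lconv3_gate_expand`: census-2 g71;
`lconv_assoc`: lead g42 (this lane).  Nothing here is a published result.  The gluing rows served [cite: KozmaNitzan2024, Conjecture 3 (p. 15)];
product measure [cite: Grimmett1999, §1.3 p. 10].
-/

noncomputable section

namespace Summit.CriticalPhenomena.PercolationContinuityZ3.Theorems

namespace Quant

open Finset

namespace LawDec

/-! ### Two partial expansions (one root opened) -/

/-- the three-forest expansion with the FIRST root opened: `ρ₁ ∗ gate_{c₂}ρ₂ ∗ gate_{c₃}ρ₃` on the sub-forest convolutions. [this work] -/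
theorem lconv3_expand_open₁ (M₁ M₂ M₃ : ℕ) (ρ₁ ρ₂ ρ₃ : ℕ → ℝ) (c₂ c₃ : ℝ)
    (h₁M : ∀ h, M₁ < h → ρ₁ h = 0) (h₂M : ∀ h, M₂ < h → ρ₂ h = 0) (h₃M : ∀ h, M₃ < h → ρ₃ h = 0) (h : ℕ) :
    lconv (M₁ + M₂) M₃ (lconv M₁ M₂ ρ₁ (gate ρ₂ c₂)) (gate ρ₃ c₃) h
      = c₂ * c₃ * lconv (M₁ + M₂) M₃ (lconv M₁ M₂ ρ₁ ρ₂) ρ₃ h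
        + c₂ * (1 - c₃) * lconv M₁ M₂ ρ₁ ρ₂ h + (1 - c₂) * c₃ * lconv M₁ M₃ ρ₁ ρ₃ h
        + (1 - c₂) * (1 - c₃) * ρ₁ h := by
  have e := lconv3_gate_expand M₁ M₂ M₃ ρ₁ ρ₂ ρ₃ 1 c₂ c₃ h₁M h₂M h₃M h
  rw [gate_one] at e
  rw [e]
  ring

/-- the three-forest expansion with the SECOND root opened: `gate_{c₁}ρ₁ ∗ ρ₂ ∗ gate_{c₃}ρ₃`. [this work] -/
theorem lconv3_expand_open₂ (M₁ M₂ M₃ : ℕ) (ρ₁ ρ₂ ρ₃ : ℕ → ℝ) (c₁ c₃ : ℝ)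
    (h₁M : ∀ h, M₁ < h → ρ₁ h = 0) (h₂M : ∀ h, M₂ < h → ρ₂ h = 0) (h₃M : ∀ h, M₃ < h → ρ₃ h = 0) (h : ℕ) :
    lconv (M₁ + M₂) M₃ (lconv M₁ M₂ (gate ρ₁ c₁) ρ₂) (gate ρ₃ c₃) h
      = c₁ * c₃ * lconv (M₁ + M₂) M₃ (lconv M₁ M₂ ρ₁ ρ₂) ρ₃ h
        + c₁ * (1 - c₃) * lconv M₁ M₂ ρ₁ ρ₂ h + (1 - c₁) * c₃ * lconv M₂ M₃ ρ₂ ρ₃ h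
        + (1 - c₁) * (1 - c₃) * ρ₂ h := by
  have e := lconv3_gate_expand M₁ M₂ M₃ ρ₁ ρ₂ ρ₃ c₁ 1 c₃ h₁M h₂M h₃M h
  rw [gate_one] at e
  rw [e]
  ring

/-! ### The identity -/

/-- **THE GENERIC THREE-ROOT GATE-COUPLING IDENTITY** (four components; see the module docstring for the reading).  An identity of
rational functions: the hypotheses only exclude vanishing denominators. [this work] -/
theorem threeRoot_gateCoupling_generic (M₁ M₂ M₃ : ℕ) (ρ₁ ρ₂ ρ₃ : ℕ → ℝ) (q₁ q₂ q₃ a R₁ R₂ : ℝ)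
    (h₁M : ∀ h, M₁ < h → ρ₁ h = 0) (h₂M : ∀ h, M₂ < h → ρ₂ h = 0) (h₃M : ∀ h, M₃ < h → ρ₃ h = 0)
    (hq₁ : q₁ ≠ 0) (hQ : q₁ + q₂ - q₁ * q₂ ≠ 0) (haQ : 1 - a * (q₁ + q₂ - q₁ * q₂) ≠ 0) (haq₁ : 1 - a * q₁ ≠ 0)
    (hR₁ : R₁ ≠ 0) (hR₂ : R₂ ≠ 0) (hD : q₁ * (1 - q₂) * R₂ + q₂ * (1 - q₁) * R₁ ≠ 0) (h : ℕ) :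
    gate (lconv (M₁ + M₂) M₃ (lconv M₁ M₂ (gate ρ₁ q₁) (gate ρ₂ q₂)) (gate ρ₃ q₃)) a h
      = ((1 - (q₁ + q₂ - q₁ * q₂)) / (1 - a * (q₁ + q₂ - q₁ * q₂))) * ((1 - q₁) / (1 - a * q₁))
          * lconv (M₁ + M₂) M₃ (lconv M₁ M₂ (gate ρ₁ (a * q₁)) (gate ρ₂ (a * q₂))) (gate ρ₃ (a * q₃)) h
        + ((1 - (q₁ + q₂ - q₁ * q₂)) / (1 - a * (q₁ + q₂ - q₁ * q₂))) * (1 - (1 - q₁) / (1 - a * q₁))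
          * lconv (M₁ + M₂) M₃ (gate (lconv M₁ M₂ ρ₁ (gate ρ₂ (q₂ / q₁))) (a * q₁)) (gate ρ₃ (a * q₃)) h
        + (1 - (1 - (q₁ + q₂ - q₁ * q₂)) / (1 - a * (q₁ + q₂ - q₁ * q₂)))
          * ((q₁ * (1 - q₂) * R₂) / (q₁ * (1 - q₂) * R₂ + q₂ * (1 - q₁) * R₁))
          * gate (lconv (M₁ + M₂) M₃ (lconv M₁ M₂ ρ₁ (gate ρ₂ (q₂ * (R₂ - (1 - q₁) * R₁) / ((q₁ + q₂ - q₁ * q₂) * R₂))))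
              (gate ρ₃ (q₃ / (q₁ + q₂ - q₁ * q₂)))) (a * (q₁ + q₂ - q₁ * q₂)) h
        + (1 - (1 - (q₁ + q₂ - q₁ * q₂)) / (1 - a * (q₁ + q₂ - q₁ * q₂)))
          * ((q₂ * (1 - q₁) * R₁) / (q₁ * (1 - q₂) * R₂ + q₂ * (1 - q₁) * R₁))
          * gate (lconv (M₁ + M₂) M₃ (lconv M₁ M₂ (gate ρ₁ (q₁ * (R₁ - (1 - q₂) * R₂) / ((q₁ + q₂ - q₁ * q₂) * R₁))) ρ₂)
              (gate ρ₃ (q₃ / (q₁ + q₂ - q₁ * q₂)))) (a * (q₁ + q₂ - q₁ * q₂)) h := by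
  have h₁₂M : ∀ k, M₁ + M₂ < k → lconv M₁ M₂ ρ₁ (gate ρ₂ (q₂ / q₁)) k = 0 := fun k hk => lconv_eq_zero _ _ _ _ k hk
  rw [gate_apply _ a h, lconv3_gate_expand M₁ M₂ M₃ ρ₁ ρ₂ ρ₃ q₁ q₂ q₃ h₁M h₂M h₃M h,
    lconv3_gate_expand M₁ M₂ M₃ ρ₁ ρ₂ ρ₃ (a * q₁) (a * q₂) (a * q₃) h₁M h₂M h₃M h,
    -- C
    lconv_gate_left (M₁ + M₂) M₃ (lconv M₁ M₂ ρ₁ (gate ρ₂ (q₂ / q₁))) _ (a * q₁) (gate_eq_zero_of_top M₃ ρ₃ (a * q₃) h₃M) h,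
    lconv3_expand_open₁ M₁ M₂ M₃ ρ₁ ρ₂ ρ₃ (q₂ / q₁) (a * q₃) h₁M h₂M h₃M h, gate_apply ρ₃ (a * q₃) h,
    -- U₁
    gate_apply (lconv (M₁ + M₂) M₃ (lconv M₁ M₂ ρ₁ (gate ρ₂ _)) (gate ρ₃ _)) _ h,
    lconv3_expand_open₁ M₁ M₂ M₃ ρ₁ ρ₂ ρ₃ _ (q₃ / (q₁ + q₂ - q₁ * q₂)) h₁M h₂M h₃M h,
    -- U₂
    gate_apply (lconv (M₁ + M₂) M₃ (lconv M₁ M₂ (gate ρ₁ _) ρ₂) (gate ρ₃ _)) _ h,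
    lconv3_expand_open₂ M₁ M₂ M₃ ρ₁ ρ₂ ρ₃ _ (q₃ / (q₁ + q₂ - q₁ * q₂)) h₁M h₂M h₃M h]
  field_simp
  ring

end LawDec

end Quant

end Summit.CriticalPhenomena.PercolationContinuityZ3.Theorems
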